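import Summits.Parity.GeneralizedHardyLittlewood.Theses.PrimeLevelFamEdge
import Literature.NumberTheory.LFunctions.KMVMomentAsymptoticsUniqueness

/-!
# `BeyondDiagonalBeatsQuarter` / `MomentsBeyondDiagonal` — Negative lane: BOTH corrections at `Q = 1`
are pinned by the `Q = 1` displays alone (refuter helper, ls-ref-1 g4)

Companion of `UniquenessAtOne.lean`. The route's deciding theorem `closes` uses
`KMV2000.MomentAsymptotics 1 Δ T₁ T₂` only at `Q = 1` (`goodMass_lower_of_momentAsymptotics`,
`hMA P 1 …`), and K_B's value claim is stated at `Q = 1`. This file records, sorry-free, that for an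
MA-consistent pair `(T₁, T₂)` the two numbers the route actually consumes — `T₁ Δ' P 1` and
`T₂ Δ' P 1` — are determined by the two `Q = 1` displays at `P` with ANY candidate corrections
`S₁, S₂ : ℝ → ℝ` (functions of the length exponent only): if those displays hold on the window then
`T₁ Δ' P 1 = S₁ Δ'` and `T₂ Δ' P 1 = S₂ Δ'`. Hence the open heart of both cruxes (the SECOND-moment
off-diagonal main term just beyond the diagonal at one prime level) is a statement about the `Q = 1`
mollified moments only; derivative displays (`Q ≠ 1`) carry no information the route uses. No Theses
statement is asserted.
-/

namespace Summit.Parity.GeneralizedHardyLittlewood.Theorems.BeyondDiagonalBeatsQuarter.Negative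

open Polynomial
open Literature.NumberTheory.LFunctions
open Literature.NumberTheory.LFunctions.KMV2000

/-- **Both corrections at `Q = 1` are pinned by the `Q = 1` displays.** If `(T₁, T₂)` is MA-consistent
on `(Δlo, Δhi]`, `P` is admissible, and the first and second KMV displays hold at `(P, 1)` on the
window with corrections `S₁ Δ`, `S₂ Δ`, then `T₁ Δ' P 1 = S₁ Δ'` and `T₂ Δ' P 1 = S₂ Δ'` for every
`Δ' ∈ (Δlo, Δhi]` with `0 < Δ' ≤ 2` (modify the pair at `(P, 1)` only and apply pointwise uniqueness,
`T₁_eq_of_momentAsymptotics_of_le_two` / `T₂_eq_of_momentAsymptotics_of_le_two`).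
[cite: KowalskiMichelVanderKam2000, §6 p. 19] -/
theorem corrections_apply_one_eq_of_displaysAtOne {Δlo Δhi : ℝ} {T₁ T₂ : ℝ → ℝ[X] → ℝ[X] → ℝ}
    (h : MomentAsymptotics Δlo Δhi T₁ T₂) {P : ℝ[X]} (hP : KMV2000.Admissible P) {S₁ S₂ : ℝ → ℝ}
    (hS : ∀ Δ : ℝ, Δlo < Δ → Δ ≤ Δhi →
      ∃ C : ℝ, ∃ q₀ : ℕ, ∀ (q : ℕ) [NeZero q], q.Prime → q₀ ≤ q →
        (∀ n : ℕ, (n : ℝ) ≠ qhat q ^ Δ) →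
          ‖LhPQ q P 1 (qhat q ^ Δ) -
              ((riemannZeta 2 * ((Real.sqrt (qhat q) / (Δ * Real.log (qhat q)) : ℝ) : ℂ)) *
                ((KMV2000.linForm Δ P 1 + S₁ Δ : ℝ) : ℂ))‖ ≤
            C * Real.sqrt (qhat q) * (Real.log (qhat q))⁻¹ ^ 2 ∧
          ‖QhPQ q P 1 (qhat q ^ Δ) -
              ((2 * riemannZeta 2 ^ 2 * ((qhat q / (Δ ^ 2 * Real.log (qhat q) ^ 2) : ℝ) : ℂ)) *
                ((KMV2000.secondMomentForm Δ P 1 + S₂ Δ : ℝ) : ℂ))‖ ≤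
            C * qhat q * (Real.log (qhat q))⁻¹ ^ 3)
    {Δ' : ℝ} (h1' : Δlo < Δ') (h2' : Δ' ≤ Δhi) (hΔ'0 : 0 < Δ') (hΔ'2 : Δ' ≤ 2) :
    T₁ Δ' P 1 = S₁ Δ' ∧ T₂ Δ' P 1 = S₂ Δ' := by
  classical
  let T₁' : ℝ → ℝ[X] → ℝ[X] → ℝ := fun Δ P' Q ↦ if P' = P ∧ Q = 1 then S₁ Δ else T₁ Δ P' Q
  let T₂' : ℝ → ℝ[X] → ℝ[X] → ℝ := fun Δ P' Q ↦ if P' = P ∧ Q = 1 then S₂ Δ else T₂ Δ P' Q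
  have e₁ : ∀ Δ, T₁' Δ P 1 = S₁ Δ := fun Δ ↦ by simp [T₁']
  have e₂ : ∀ Δ, T₂' Δ P 1 = S₂ Δ := fun Δ ↦ by simp [T₂']
  have h' : MomentAsymptotics Δlo Δhi T₁' T₂' := by
    intro P' Q hP' hQ Δ hlo hhi
    by_cases hc : P' = P ∧ Q = 1
    · obtain ⟨rfl, rfl⟩ := hc
      obtain ⟨C, q₀, H⟩ := hS Δ hlo hhi
      refine ⟨C, q₀, fun q _ hq hq₀ hM ↦ ?_⟩
      rw [e₁ Δ, e₂ Δ]
      exact H q hq hq₀ hM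
    · obtain ⟨C, q₀, H⟩ := h P' Q hP' hQ Δ hlo hhi
      refine ⟨C, q₀, fun q _ hq hq₀ hM ↦ ?_⟩
      have f₁ : T₁' Δ P' Q = T₁ Δ P' Q := by simp [T₁', hc]
      have f₂ : T₂' Δ P' Q = T₂ Δ P' Q := by simp [T₂', hc]
      rw [f₁, f₂]
      exact H q hq hq₀ hM
  refine ⟨?_, ?_⟩
  · rw [T₁_eq_of_momentAsymptotics_of_le_two h h' hP isEvenOrOdd_one h1' h2' hΔ'0 hΔ'2]
    exact e₁ Δ'
  · rw [T₂_eq_of_momentAsymptotics_of_le_two h h' hP isEvenOrOdd_one h1' h2' hΔ'0 hΔ'2]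
    exact e₂ Δ'

end Summit.Parity.GeneralizedHardyLittlewood.Theorems.BeyondDiagonalBeatsQuarter.Negative
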